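import Summits.QuantumFields.BalabanUV.Beta.FP.CompositeBorderTablesLetters
import Summits.QuantumFields.BalabanUV.Beta.FP.PerfectSecondOrderTablesDressed
import Summits.QuantumFields.BalabanUV.Beta.FP.PerfectSecondOrderTablesTranslate

/-!
# `BalabanUV.Beta.FP.CompositeStencilTables` — road «FP» for binder row D1, RULING **R-FP-50 (a)** (OWNER d1-p3 g16, journal l.35761 «then `SLamComp` + `SfoldComp` +
# `WtComp`»): THE COMPOSITE FIRST-ORDER STENCIL SLOT `SpureComp … m` (pure part), `SfoldComp … m` (pure + the composite Λ-fold, the fold a DISPLAYED family) and THE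
# m-FOLD SECOND-ORDER TABLE OF RECORD WITH COMPOSITE STENCIL SLOTS `WtComp … m := WtInf G tabs cΛ (SpureComp … m) (S₂Comp … m) m` — objects RELATIVE to the m = 1
# letters, `m = 1` members the literal's by `rfl`, plus their letters (locality, (St♭)∕(Wt) at blocking `Lc^m`) from FILE `CompositeBorderTablesLetters` and my g14
# `vertexFamily₂_WtInf` ∕ `WtInf_translate` BY NAME; and the RECORD-LEVEL UNCONDITIONAL letters of `V^{(m)}` (inputs `qSym Lc`, `lamPerfect`, `tabs.V`, `tabs.vh₂S`)

HONEST DEPENDENCY (page 1, mandatory): continuum YM on T⁴ ⇐ BetaPertH ∧ nine spine estimates (0/9 proved); BetaPertH ⇐ (D1) ∧ (D4) ∧ CAP+tail;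
G-an2-4 gates asym, D1 and NE2/3/4.  HONEST FRAMING (cell contract, verbatim): «discharging `BetaPertH` makes Bałaban's UV stability UNCONDITIONAL —
a real constructive-QFT result; it is NOT the continuum limit and NOT the Clay problem.»  ABSOLUTE RULE (cell charter, verbatim): «No internally-minted
statement may enter as a cited fact. Every hypothesis is either kernel-proved in this package or a verbatim quotation of a PUBLISHED theorem with page
reference. The manuscript(s) under audit are NOT citable for their own disputed steps — they are the thing under adjudication; programme-internal
(2001/route/tribunal) claims are never citable.»  THIS MODULE DEFINES OUR OBJECTS (candidates asserting nothing; «not in print») over existing objects and proves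
unfoldings, `m = 1` pins and [folklore] letters BY NAME.  0 `def … : Prop`, nothing cited, 0 sorry; 0 estimates; 0∕4 row-D1 binders; NOT the END re-base (leaf-06), NOT the
composite Λ-fold `SLamComp` itself (an4's fold API; DISPLAYED as a family `SLam : ℕ → …`), NOT (J-S)(J-W), NOT SDF, NOT D1, NOT BetaPertH, NOT continuum, NOT Clay.
DEFINITION lane (reviewed).  SCOPE as FILE `CompositeBorderTables` (averaging rows only; slice rows = Q-FP-16-6).

CONTENT (generic `d`).
* §1 **`SpureComp Lc q λ V Spure cVH m := if m = 1 then Spure else (Spure − cVH 1 • V) + cVH m • VComp Lc q λ V m`** — the PURE first-order stencil slot at level `m` RELATIVE to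
  the m = 1 letter `S♭∞` (whose border part is `cVH•tabs.V`; R-FP-50 (a) `SpureComp m := SΔ∞ + cVH^{(m)}•V^{(m)}` with `SΔ∞ := S♭∞ − cVH•tabs.V`, no split of the (S♭) rows by
  piece needed); **`SfoldComp … SLam m := SpureComp … m + SLam m`** (the END's first-order slot; `SLam m` the composite Λ-fold, DISPLAYED); **`WtComp ε G tabs cΛ q λ Spure cVH S₂inf cB m
  := WtInf G tabs cΛ (SpureComp Lc q λ tabs.V Spure cVH m) (S₂Comp ε Lc q λ tabs.V tabs.vh₂S S₂inf cB m) m`** (D2's carrier with COMPOSITE stencil slots — R-FP-50 (a) `WtComp`);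
  `SpureComp_one`, `SfoldComp_one`, `WtComp_one` (the m = 1 members are the literal's: `Spure`, `Spure + SLam 1`, `WtInf G tabs cΛ Spure S₂inf 1`), unfoldings off `m = 1`.
* §2 letters (generic inputs at one common rate): `locStencil_SpureComp`, `SpureComp_translate` ((St♭) at blocking `Lc^m`), `locStencil_SfoldComp`, **`vertexFamily₂_WtComp`**
  (my g14 `vertexFamily₂_WtInf` at the composite slots' letters), **`WtComp_translate`** ((Wt) at blocking `Lc^m`, g14 `WtInf_translate`).
* §3 RECORD-LEVEL UNCONDITIONAL letters of the border tables (inputs `(qSym Lc, lamPerfect, tabs.V, tabs.vh₂S)`; g14 `abs_qSym_le` ∕ `qSym_translate`, `SymTables.hV∕hB∕hVt∕hBt`):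
  **`locStencil_VComp_record`**, **`VComp_record_translate`**, **`locStencil₂_V₂Comp_record`**, **`V₂Comp_record_translate`** — what the END re-base consumes with no hypothesis.
Provenance: D1 formalisation swarm LEAF PROVER 02, unit b2b-balaban-beta-d1-formalise-leaf-02 gen 15, 2026-08-21 (R-FP-50 (a)).  No existing file touched.
-/

noncomputable section

namespace Summit.QuantumFields.BalabanUV.Beta.FP.CompositeStencilTables

open Literature.MathematicalPhysics.QuantumFieldTheory.Balaban1983to89
open Literature.MathematicalPhysics.QuantumFieldTheory.Balaban1983to89.Beta
open B12Sec2to5 (l1 l1_nonneg)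
open ExpKernelCalculus (MKer Decays BiLoc VertexFamily₂ shiftK)
open AffineAveraging (Site)
open OneStepResolventKernel (Fib LocStencil biLoc_mono)
open BalabanStepJets (locStencil_mono)
open BalabanCompositeJets (LocStencil₂)
open SecondOrderResponse (biLoc_smul)
open KernelWard (biLoc_add biLoc_sub)
open Summit.QuantumFields.BalabanUV.Beta.SymmetrisedStepJets (SymTables)
open Summit.QuantumFields.BalabanUV.Beta.FP.PerfectSecondOrderTablesInf (qSym lamPerfect WtInf)
open Summit.QuantumFields.BalabanUV.Beta.BorderedHessian (cBH cBH_nonneg)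
open Summit.QuantumFields.BalabanUV.Beta.DshAn1 (cDsh cDsh_nonneg)
open Summit.QuantumFields.BalabanUV.Beta.FP.PerfectSecondOrderTablesLetters (abs_qSym_le)
open Summit.QuantumFields.BalabanUV.Beta.FP.PerfectSecondOrderTablesDressed (vertexFamily₂_WtInf)
open Summit.QuantumFields.BalabanUV.Beta.FP.PerfectSecondOrderTablesTranslate (qSym_translate WtInf_translate)
open Summit.QuantumFields.BalabanUV.Beta.FP.CompositeBorderTables (VComp V₂Comp S₂Comp VComp_one VComp_inl_inl)
open Summit.QuantumFields.BalabanUV.Beta.FP.CompositeBorderTablesLetters (locStencil_VComp VComp_translate locStencil₂_V₂Comp locStencil₂_S₂Comp V₂Comp_translate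
  S₂Comp_translate)

variable {d : ℕ}

/-! ## §1 The objects -/

section Objects

variable (Lc : ℕ) (q : Fin (d + 1) → Site (d + 1) → Fin (d + 1) → Site (d + 1) → ℝ) (lam : ℝ) (V : Fin (d + 1) → Site (d + 1) → MKer (d + 1) (Fib d))
  (Spure : Fin (d + 1) → Site (d + 1) → MKer (d + 1) (Fib d)) (cVH : ℕ → ℝ)

/-- [our object — a CANDIDATE asserting nothing] **THE PURE FIRST-ORDER STENCIL SLOT AT LEVEL `m`** (R-FP-50 (a) `SpureComp`), RELATIVE to the m = 1 letter `S♭∞ =: Spure`: at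
`m = 1` the letter; for `m ≠ 1` its one-step border part `cVH 1 • V` (the literal: `cVH • tabs.V`) REPLACED by the composite `cVH m • V^{(m)}` — the cubic (ff) part being level-free. -/
def SpureComp (m : ℕ) : Fin (d + 1) → Site (d + 1) → MKer (d + 1) (Fib d) :=
  if m = 1 then Spure else fun κ u => (Spure κ u - cVH 1 • V κ u) + cVH m • VComp Lc q lam V m κ u

/-- [folklore] **THE m = 1 PIN** (`rfl`). -/
theorem SpureComp_one : SpureComp Lc q lam V Spure cVH 1 = Spure := if_pos rfl

/-- [folklore] Off `m = 1`. -/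
theorem SpureComp_of_ne_one {m : ℕ} (hm : m ≠ 1) :
    SpureComp Lc q lam V Spure cVH m = fun κ u => (Spure κ u - cVH 1 • V κ u) + cVH m • VComp Lc q lam V m κ u := if_neg hm

/-- [folklore] **THE ff BLOCK IS LEVEL-FREE** (`m ≠ 1`; one-step border table without ff block): on `(inl, inl)` entries `SpureComp … m = Spure`. -/
theorem SpureComp_inl_inl {m : ℕ} (hm : m ≠ 1) (hV : ∀ κ u x z (α α' : Fin (d + 1)), V κ u x z (Sum.inl α) (Sum.inl α') = 0)
    (κ : Fin (d + 1)) (u x z : Site (d + 1)) (α α' : Fin (d + 1)) :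
    SpureComp Lc q lam V Spure cVH m κ u x z (Sum.inl α) (Sum.inl α') = Spure κ u x z (Sum.inl α) (Sum.inl α') := by
  rw [SpureComp_of_ne_one Lc q lam V Spure cVH hm]
  simp only [Pi.add_apply, Pi.sub_apply, Pi.smul_apply, smul_eq_mul, hV, VComp_inl_inl Lc q lam V hm, mul_zero, sub_zero, add_zero]

variable (SLam : ℕ → Fin (d + 1) → Site (d + 1) → MKer (d + 1) (Fib d))

/-- [our object — a CANDIDATE asserting nothing] **THE END's FIRST-ORDER SLOT AT LEVEL `m`** (R-FP-50 (a) `SfoldComp`): pure part + the composite Λ-fold `SLam m` (a DISPLAYED family: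
an4's fold of `MCompInf m` through `colM (KPerf m)`; `SLam 1` = the literal's fold). -/
def SfoldComp (m : ℕ) : Fin (d + 1) → Site (d + 1) → MKer (d + 1) (Fib d) := fun κ u => SpureComp Lc q lam V Spure cVH m κ u + SLam m κ u

/-- [folklore] **THE m = 1 MEMBER**: `SfoldComp … 1 = Spure + SLam 1` (the literal's `S♭∞ + SLam∞`). -/
theorem SfoldComp_one : SfoldComp Lc q lam V Spure cVH SLam 1 = fun κ u => Spure κ u + SLam 1 κ u := by
  funext κ u; rw [SfoldComp, SpureComp_one]

/-- [folklore] Unfolding. -/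
theorem SfoldComp_apply (m : ℕ) (κ : Fin (d + 1)) (u : Site (d + 1)) :
    SfoldComp Lc q lam V Spure cVH SLam m κ u = SpureComp Lc q lam V Spure cVH m κ u + SLam m κ u := rfl

variable (ε : ℝ) (G : ℕ → MKer (d + 1) (Fib d)) (tabs : SymTables d Lc) (cΛ : ℝ)
  (S₂inf : Fin (d + 1) → Site (d + 1) → Fin (d + 1) → Site (d + 1) → MKer (d + 1) (Fib d)) (cB : ℕ → ℝ)

/-- [our object — a CANDIDATE asserting nothing] **THE m-FOLD SECOND-ORDER TABLE OF RECORD WITH COMPOSITE STENCIL SLOTS** (R-FP-50 (a) `WtComp`): D2's carrier `WtInf` with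
`(S∞, S₂∞) ↦ (SpureComp … m, S₂Comp … m)` over the record's border tables `tabs.V`, `tabs.vh₂S` — the multiplier ∕ mixed slots were already composite (D2), the K-slot placement
caveat of D2 §3 unchanged. -/
def WtComp (m : ℕ) : Fin (d + 1) → Site (d + 1) → Fin (d + 1) → Site (d + 1) → MKer (d + 1) (Fib d) :=
  WtInf G tabs cΛ (SpureComp Lc q lam tabs.V Spure cVH m) (S₂Comp ε Lc q lam tabs.V tabs.vh₂S S₂inf cB m) m

/-- [folklore] **THE m = 1 MEMBER IS D2's** (hence parts 1–2's): `WtComp … 1 = WtInf G tabs cΛ Spure S₂inf 1`. -/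
theorem WtComp_one : WtComp Lc q lam Spure cVH ε G tabs cΛ S₂inf cB 1 = WtInf G tabs cΛ Spure S₂inf 1 := by
  rw [WtComp, SpureComp_one, CompositeBorderTables.S₂Comp_one]

/-- [folklore] Unfolding. -/
theorem WtComp_eq (m : ℕ) : WtComp Lc q lam Spure cVH ε G tabs cΛ S₂inf cB m
    = WtInf G tabs cΛ (SpureComp Lc q lam tabs.V Spure cVH m) (S₂Comp ε Lc q lam tabs.V tabs.vh₂S S₂inf cB m) m := rfl

end Objects

/-! ## §2 Letters of the stencil slots and of the carrier (generic inputs) -/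

section Letters

variable {Lc : ℕ} [NeZero Lc] {q : Fin (d + 1) → Site (d + 1) → Fin (d + 1) → Site (d + 1) → ℝ} {Cq δ : ℝ}
  {V : Fin (d + 1) → Site (d + 1) → MKer (d + 1) (Fib d)} {CV : ℝ} {Spure : Fin (d + 1) → Site (d + 1) → MKer (d + 1) (Fib d)} {Cs : ℝ}

/-- [our object — bookkeeping] **THE PURE SLOT IS A LOCAL STENCIL FAMILY** (`m ≥ 1`): `m = 1` the letter of `S♭∞`; else `biLoc_sub∕add∕smul` at the minimum rate over
FILE-letters' `locStencil_VComp`. -/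
theorem locStencil_SpureComp (hq : ∀ ρ w κ u, |q ρ w κ u| ≤ Cq * Real.exp (-δ * l1 (u - (Lc : ℤ) • w))) (hCq : 0 ≤ Cq) (hδ : 0 < δ)
    (hV : LocStencil V CV δ) (hSp : LocStencil Spure Cs δ) (lam : ℝ) (cVH : ℕ → ℝ) {m : ℕ} (hm : 1 ≤ m) :
    ∃ C δ' : ℝ, 0 < δ' ∧ LocStencil (SpureComp Lc q lam V Spure cVH m) C δ' := by
  by_cases h1 : m = 1
  · subst h1
    exact ⟨Cs, δ, hδ, by rw [SpureComp_one]; exact hSp⟩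
  · obtain ⟨C, δ', hδ', hX⟩ := locStencil_VComp hq hCq hδ hV lam hm
    have hCs : 0 ≤ Cs := (hSp 0 0).nonneg (Sum.inl 0)
    have hCV : 0 ≤ CV := (hV 0 0).nonneg (Sum.inl 0)
    have hC : 0 ≤ C := (hX 0 0).nonneg (Sum.inl 0)
    set r : ℝ := min δ δ' with hr
    have hr0 : 0 < r := lt_min hδ hδ'
    refine ⟨Cs + |cVH 1| * CV + |cVH m| * C, r, hr0, fun κ u => ?_⟩
    rw [SpureComp_of_ne_one Lc q lam V Spure cVH h1]
    exact biLoc_add (biLoc_sub (biLoc_mono (hSp κ u) hCs (min_le_left _ _)) (biLoc_smul (cVH 1) (biLoc_mono (hV κ u) hCV (min_le_left _ _))))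
      (biLoc_smul (cVH m) (biLoc_mono (hX κ u) hC (min_le_right _ _)))

omit [NeZero Lc] in
/-- [folklore] Block covariance at blocking `Lc` iterates to blocking `Lc^m` (`m ≥ 1`). -/
theorem blockCov_pow {S : Fin (d + 1) → Site (d + 1) → MKer (d + 1) (Fib d)}
    (hSt : ∀ (κ : Fin (d + 1)) (u t : Site (d + 1)), S κ (u + (Lc : ℤ) • t) = shiftK (-((Lc : ℤ) • t)) (S κ u)) {m : ℕ} (hm : 1 ≤ m)
    (κ : Fin (d + 1)) (u t : Site (d + 1)) : S κ (u + (((Lc ^ m : ℕ) : ℤ)) • t) = shiftK (-((((Lc ^ m : ℕ) : ℤ)) • t)) (S κ u) := by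
  obtain ⟨m', rfl⟩ : ∃ m', m = m' + 1 := ⟨m - 1, by omega⟩
  have e : (((Lc ^ (m' + 1) : ℕ) : ℤ)) • t = (Lc : ℤ) • ((((Lc ^ m' : ℕ) : ℤ)) • t) := by
    rw [smul_smul]; congr 1; push_cast; ring
  rw [e]; exact hSt κ u _

/-- [our object — bookkeeping] **(St♭) OF THE PURE SLOT AT BLOCKING `Lc^m`** (`m ≥ 1`) from (T-q), the one-step (TV) of `V` and the (St♭) of `S♭∞` at blocking `Lc`. -/
theorem SpureComp_translate
    (hq : ∀ (ρ : Fin (d + 1)) (w : Site (d + 1)) (κ : Fin (d + 1)) (u t : Site (d + 1)), q ρ (w + t) κ (u + (Lc : ℤ) • t) = q ρ w κ u)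
    (hVt : ∀ (κ : Fin (d + 1)) (u t : Site (d + 1)), V κ (u + (Lc : ℤ) • t) = shiftK (-((Lc : ℤ) • t)) (V κ u))
    (hSpt : ∀ (κ : Fin (d + 1)) (u t : Site (d + 1)), Spure κ (u + (Lc : ℤ) • t) = shiftK (-((Lc : ℤ) • t)) (Spure κ u))
    (lam : ℝ) (cVH : ℕ → ℝ) {m : ℕ} (hm : 1 ≤ m) (κ : Fin (d + 1)) (u t : Site (d + 1)) :
    SpureComp Lc q lam V Spure cVH m κ (u + (((Lc ^ m : ℕ) : ℤ)) • t) = shiftK (-((((Lc ^ m : ℕ) : ℤ)) • t)) (SpureComp Lc q lam V Spure cVH m κ u) := by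
  by_cases h1 : m = 1
  · subst h1
    rw [SpureComp_one]
    exact blockCov_pow hSpt le_rfl κ u t
  · rw [SpureComp_of_ne_one Lc q lam V Spure cVH h1]
    show (Spure κ (u + (((Lc ^ m : ℕ) : ℤ)) • t) - cVH 1 • V κ (u + (((Lc ^ m : ℕ) : ℤ)) • t)) + cVH m • VComp Lc q lam V m κ (u + (((Lc ^ m : ℕ) : ℤ)) • t)
      = shiftK (-((((Lc ^ m : ℕ) : ℤ)) • t)) ((Spure κ u - cVH 1 • V κ u) + cVH m • VComp Lc q lam V m κ u)
    rw [blockCov_pow hSpt hm, blockCov_pow hVt hm, VComp_translate hq hVt lam m]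
    rfl

variable {SLam : ℕ → Fin (d + 1) → Site (d + 1) → MKer (d + 1) (Fib d)}

/-- [our object — bookkeeping] **THE END's FIRST-ORDER SLOT IS A LOCAL STENCIL FAMILY** given a letter of the displayed fold member `SLam m`. -/
theorem locStencil_SfoldComp (hq : ∀ ρ w κ u, |q ρ w κ u| ≤ Cq * Real.exp (-δ * l1 (u - (Lc : ℤ) • w))) (hCq : 0 ≤ Cq) (hδ : 0 < δ)
    (hV : LocStencil V CV δ) (hSp : LocStencil Spure Cs δ) (lam : ℝ) (cVH : ℕ → ℝ) {m : ℕ} (hm : 1 ≤ m) {CL δL : ℝ} (hL : LocStencil (SLam m) CL δL)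
    (hδL : 0 < δL) : ∃ C δ' : ℝ, 0 < δ' ∧ LocStencil (SfoldComp Lc q lam V Spure cVH SLam m) C δ' := by
  obtain ⟨C, δ', hδ', hX⟩ := locStencil_SpureComp hq hCq hδ hV hSp lam cVH hm
  have hC : 0 ≤ C := (hX 0 0).nonneg (Sum.inl 0)
  have hCL : 0 ≤ CL := (hL 0 0).nonneg (Sum.inl 0)
  refine ⟨C + CL, min δ' δL, lt_min hδ' hδL, fun κ u => ?_⟩
  exact biLoc_add (biLoc_mono (hX κ u) hC (min_le_left _ _)) (biLoc_mono (hL κ u) hCL (min_le_right _ _))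

variable {G : ℕ → MKer (d + 1) (Fib d)} (tabs : SymTables d Lc) (cΛ ε : ℝ)
  {S₂inf : Fin (d + 1) → Site (d + 1) → Fin (d + 1) → Site (d + 1) → MKer (d + 1) (Fib d)} {C₂ : ℝ}

/-- [our object — bookkeeping] **THE COMPOSITE-SLOT CARRIER IS A VERTEX FAMILY AT BLOCKING `Lc^(m+1)`** (every `m`; SOME rate): my g14 `vertexFamily₂_WtInf` fed with the composite
slots' letters (`locStencil_SpureComp`, FILE-letters' `locStencil₂_S₂Comp`) — inputs: (Lq), the one-step border letters of `tabs.V` ∕ `tabs.vh₂S` at the common rate, the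
m = 1 letters of `S♭∞` ∕ `S₂∞`, a `Decays` letter of the K-slot `G (m+1)`. -/
theorem vertexFamily₂_WtComp (hq : ∀ ρ w κ u, |q ρ w κ u| ≤ Cq * Real.exp (-δ * l1 (u - (Lc : ℤ) • w))) (hCq : 0 ≤ Cq) (hδ : 0 < δ)
    (hV : LocStencil tabs.V CV δ) (hB : LocStencil₂ tabs.vh₂S C₂ δ) (hSp : LocStencil Spure Cs δ) {C₂' : ℝ} (hS₂ : LocStencil₂ S₂inf C₂' δ)
    (lam : ℝ) (cVH cB : ℕ → ℝ) (m : ℕ) (hG : ∃ δ₀ C : ℝ, 0 < δ₀ ∧ 0 ≤ C ∧ Decays (G (m + 1)) C δ₀) :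
    ∃ Cw δw : ℝ, 0 < δw ∧ VertexFamily₂ (WtComp Lc q lam Spure cVH ε G tabs cΛ S₂inf cB (m + 1)) (Lc ^ (m + 1)) Cw δw := by
  obtain ⟨C₁, δ₁, hδ₁, h₁⟩ := locStencil_SpureComp hq hCq hδ hV hSp lam cVH (Nat.succ_le_succ (Nat.zero_le m))
  obtain ⟨C₃, δ₃, hδ₃, h₃⟩ := locStencil₂_S₂Comp ε hq hCq hδ hV hB hS₂ lam cB (Nat.succ_le_succ (Nat.zero_le m))
  rw [WtComp_eq]
  exact vertexFamily₂_WtInf tabs cΛ m hG h₁ hδ₁ h₃ hδ₃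

/-- [our object — bookkeeping] **(Wt) OF THE COMPOSITE-SLOT CARRIER AT BLOCKING `Lc^m`** (`m ≥ 1`): g14 `WtInf_translate` fed with `SpureComp_translate` ∕ FILE-letters'
`S₂Comp_translate`; inputs: (T-q), the one-step (TV)∕(TB) of the record's border tables, the (St♭)∕(TB) of the m = 1 letters (the latter at blocking `Lc^m`), the
`Lc^m`-shift invariance of `G m`. -/
theorem WtComp_translate
    (hq : ∀ (ρ : Fin (d + 1)) (w : Site (d + 1)) (κ : Fin (d + 1)) (u t : Site (d + 1)), q ρ (w + t) κ (u + (Lc : ℤ) • t) = q ρ w κ u)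
    (hSpt : ∀ (κ : Fin (d + 1)) (u t : Site (d + 1)), Spure κ (u + (Lc : ℤ) • t) = shiftK (-((Lc : ℤ) • t)) (Spure κ u))
    (lam : ℝ) (cVH cB : ℕ → ℝ) {m : ℕ} (hm : 1 ≤ m) (hG : ∀ t : Site (d + 1), shiftK (-((((Lc ^ m : ℕ) : ℤ)) • t)) (G m) = G m)
    (hS₂t : ∀ (κ : Fin (d + 1)) (u : Site (d + 1)) (κ' : Fin (d + 1)) (u' t : Site (d + 1)),
      S₂inf κ (u + (((Lc ^ m : ℕ) : ℤ)) • t) κ' (u' + (((Lc ^ m : ℕ) : ℤ)) • t) = shiftK (-((((Lc ^ m : ℕ) : ℤ)) • t)) (S₂inf κ u κ' u'))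
    (μ : Fin (d + 1)) (y : Site (d + 1)) (ν : Fin (d + 1)) (y' t : Site (d + 1)) :
    WtComp Lc q lam Spure cVH ε G tabs cΛ S₂inf cB m μ (y + t) ν (y' + t)
      = shiftK (-((((Lc ^ m : ℕ) : ℤ)) • t)) (WtComp Lc q lam Spure cVH ε G tabs cΛ S₂inf cB m μ y ν y') := by
  rw [WtComp_eq]
  exact WtInf_translate tabs cΛ m hG (SpureComp_translate hq tabs.hVt hSpt lam cVH hm) (S₂Comp_translate ε hq tabs.hVt tabs.hBt lam cB hm hS₂t) μ y ν y' t

end Letters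

/-! ## §3 Record-level UNCONDITIONAL letters of the border tables (inputs `qSym Lc`, `lamPerfect`, `tabs.V`, `tabs.vh₂S`) -/

section Record

variable {Lc : ℕ} [NeZero Lc] (tabs : SymTables d Lc)

/-- [folklore] The record's one-step weight `qSym Lc` obeys (Lq) at EVERY rate (g14 `abs_qSym_le`), packaged. -/
theorem qSym_decays (δ : ℝ) (hδ : 0 ≤ δ) : ∃ Cq : ℝ, 0 ≤ Cq ∧ ∀ (ρ : Fin (d + 1)) (w : Site (d + 1)) (κ : Fin (d + 1)) (u : Site (d + 1)),
    |qSym Lc ρ w κ u| ≤ Cq * Real.exp (-δ * l1 (u - (Lc : ℤ) • w)) :=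
  ⟨(cBH d Lc + cDsh d Lc) * Real.exp (δ * (((d : ℝ) + 1) * (2 * Lc))),
    mul_nonneg (add_nonneg (cBH_nonneg d Lc) (cDsh_nonneg d Lc)) (Real.exp_pos _).le, fun ρ w κ u => abs_qSym_le hδ ρ w κ u⟩

/-- [our object — bookkeeping] **`V^{(m)}` OF RECORD IS A LOCAL STENCIL FAMILY, UNCONDITIONALLY** (`m ≥ 1`; an2's `SymTables` letters (LV) + g14's (Lq) for `qSym`). -/
theorem locStencil_VComp_record {m : ℕ} (hm : 1 ≤ m) : ∃ C δ' : ℝ, 0 < δ' ∧ LocStencil (VComp Lc (qSym Lc) lamPerfect tabs.V m) C δ' := by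
  obtain ⟨Cq, hCq, hq⟩ := qSym_decays (Lc := Lc) (d := d) 1 zero_le_one
  obtain ⟨CV, hV⟩ := tabs.hV 1 zero_le_one
  exact locStencil_VComp hq hCq one_pos hV lamPerfect hm

/-- [our object — bookkeeping] **(TV) OF `V^{(m)}` OF RECORD AT BLOCKING `Lc^m`, UNCONDITIONALLY** (every `m`; g14 `qSym_translate` + (TV) of `tabs.V`). -/
theorem VComp_record_translate (m : ℕ) (κ : Fin (d + 1)) (u t : Site (d + 1)) :
    VComp Lc (qSym Lc) lamPerfect tabs.V m κ (u + (((Lc ^ m : ℕ) : ℤ)) • t) = shiftK (-((((Lc ^ m : ℕ) : ℤ)) • t)) (VComp Lc (qSym Lc) lamPerfect tabs.V m κ u) :=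
  VComp_translate (qSym_translate Lc) tabs.hVt lamPerfect m κ u t

/-- [our object — bookkeeping] **THE SECOND-ORDER BORDER TABLE OF RECORD IS A LOCAL BI-STENCIL FAMILY, UNCONDITIONALLY** (`m ≥ 1`; (LV), (LB), (Lq) at the rate of (LB)). -/
theorem locStencil₂_V₂Comp_record (ε : ℝ) {m : ℕ} (hm : 1 ≤ m) :
    ∃ C δ' : ℝ, 0 < δ' ∧ LocStencil₂ (V₂Comp ε Lc (qSym Lc) lamPerfect tabs.V tabs.vh₂S m) C δ' := by
  obtain ⟨CB, δB, hδB, hB⟩ := tabs.hB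
  obtain ⟨Cq, hCq, hq⟩ := qSym_decays (Lc := Lc) (d := d) δB hδB.le
  obtain ⟨CV, hV⟩ := tabs.hV δB hδB.le
  exact locStencil₂_V₂Comp ε hq hCq hδB hV hB lamPerfect hm

/-- [our object — bookkeeping] **(TB) OF THE SECOND-ORDER BORDER TABLE OF RECORD AT BLOCKING `Lc^m`, UNCONDITIONALLY** (every `m`). -/
theorem V₂Comp_record_translate (ε : ℝ) (m : ℕ) (κ : Fin (d + 1)) (u : Site (d + 1)) (κ' : Fin (d + 1)) (u' t : Site (d + 1)) :
    V₂Comp ε Lc (qSym Lc) lamPerfect tabs.V tabs.vh₂S m κ (u + (((Lc ^ m : ℕ) : ℤ)) • t) κ' (u' + (((Lc ^ m : ℕ) : ℤ)) • t)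
      = shiftK (-((((Lc ^ m : ℕ) : ℤ)) • t)) (V₂Comp ε Lc (qSym Lc) lamPerfect tabs.V tabs.vh₂S m κ u κ' u') :=
  V₂Comp_translate ε (qSym_translate Lc) tabs.hVt tabs.hBt lamPerfect m κ u κ' u' t

end Record

end Summit.QuantumFields.BalabanUV.Beta.FP.CompositeStencilTables

end
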